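import Mathlib.Analysis.Calculus.MeanValue
import Mathlib.Analysis.Calculus.Deriv.Pow
import Mathlib.Analysis.SpecialFunctions.ExpDeriv
import HarnessLib

/-!
# Carleman linearisation of a dissipative quadratic ODE: truncation error (scalar case)

Liu–Kolden–Krovi–Loureiro–Trivisa–Childs, *Efficient quantum algorithm for dissipative nonlinear
differential equations*, PNAS 118 (2021) e2026805118 [LiuEtAl2021Carleman], §3 (problem (2.1)
`du/dt = F₂ u^{⊗2} + F₁ u + F₀(t)`, `Re λ₁(F₁) < 0`, `R := (‖u_in‖‖F₂‖ + ‖F₀‖/‖u_in‖)/|Re λ₁|`;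
Carleman variables `ŷ_j ≈ u^{⊗j}`, `j = 1, …, N`, truncated at order `N`):

* **Lemma 1** (held text `paper:arxiv-2011.03185` chunk p0008): if `R < 1` then
  `‖u(t)‖ < ‖u_in‖` for every `t > 0` (proof: `d‖u‖/dt ≤ ‖F₂‖‖u‖² + Re(λ₁)‖u‖ + ‖F₀‖`).
* **Corollary 1** (homogeneous case `F₀ = 0`, chunks p0009–p0010, "This analysis follows the proof
  in [FP17] closely"): for every `j ∈ [N]` the truncation error `η_j(t) := u^{⊗j}(t) − ŷ_j(t)`
  satisfies `‖η_j(t)‖ ≤ ‖u_in‖^j R^{N+1−j}`; proof by BACKWARD SUBSTITUTION in the upper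
  block-bidiagonal error system `η_j' = A_j^j η_j + A_{j+1}^j η_{j+1}` (`j < N`),
  `η_N' = A_N^N η_N + A_{N+1}^N u^{⊗(N+1)}`, using `‖e^{A_j^j t}‖ = e^{j Re(λ₁) t}`,
  `‖A_{j+1}^j‖ = j‖F₂‖` and `∫₀ᵗ e^{j Re(λ₁)(t−s)} ds ≤ 1/(j|Re λ₁|)`.

This file formalises the **scalar case `n = 1`** (one real unknown, `F₂ = a`, `F₁ = b < 0`,
`F₀ = 0`), which carries the whole mechanism: the Carleman variables are the monomials `u^j`, which
satisfy EXACTLY `d(u^j)/dt = j b u^j + j a u^{j+1}`, the truncated system drops `u^{N+1}`, and the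
error obeys the same bidiagonal recursion. Everything is stated for ARBITRARY functions satisfying
the differential equations on `[0, ∞)` (`HasDerivAt` hypotheses; no existence/uniqueness theory is
invoked), so the results apply verbatim to any numerical or exact solution pair.

* `abs_le_of_hasDerivAt_linear_forced` — the back-substitution step: `e' = κe + f`, `κ < 0`,
  `e(0) = 0`, `|f| ≤ B` on `[0, t)` ⇒ `|e(t)| ≤ B(1 − e^{κt})/|κ| ≤ B/|κ|` (integrating factor +
  Mathlib's fencing lemma `image_norm_le_of_norm_deriv_right_le_deriv_boundary`).
* `abs_le_abs_init` — Lemma 1, scalar homogeneous case: `b < 0`, `|a|·|u(0)| < |b|` (i.e. `R < 1`)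
  ⇒ `|u(t)| ≤ |u(0)|` for `t ≥ 0`.
* `truncation_error_le` — Corollary 1 (first bound), scalar case, with the a-priori bound
  `|u| ≤ M` on `[0, ∞)` as a hypothesis: `|u(t)^j − ŷ_j(t)| ≤ M^j (M|a|/|b|)^{N+1−j}`.
* `truncation_error_le_of_R_lt_one` — the printed form: under `R := |u(0)||a|/|b| < 1`,
  `|u(t)^j − ŷ_j(t)| ≤ |u(0)|^j R^{N+1−j}`, in particular `|u(t) − ŷ₁(t)| ≤ |u(0)| R^N`.

-- TODO(general form): the `n`-dimensional statement with Kronecker powers `u^{⊗j} ∈ ℝ^{n^j}`,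
-- the inhomogeneous Lemma 2 (`‖η(t)‖ ≤ tN‖F₂‖‖u_in‖^{N+1}`) and the sharper `j = 1` bound
-- `‖u_in‖ R^N (1 − e^{Re(λ₁)t})^N` ([FP17] Lemma 5.2) are not formalised here.

Consumers in this project: the `pub-qadeq` adjudications of Carleman-based quantum ODE/PDE claims
(CLAIMS A-34, A-38, A-100, A-116), which cite the `R < 1` convergence condition.

## References

* J.-P. Liu, H. Ø. Kolden, H. K. Krovi, N. F. Loureiro, K. Trivisa, A. M. Childs, *Efficient
  quantum algorithm for dissipative nonlinear differential equations*, PNAS 118 (35) (2021),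
  arXiv:2011.03185, Lemma 1 and Corollary 1. [LiuEtAl2021Carleman]
* M. Forets, A. Pouly, *Explicit error bounds for Carleman linearization*, arXiv:1711.02552
  (2017), Thm. 4.2 / Lemma 5.2. [ForetsPouly2017]
-/

noncomputable section

open Set Real

namespace Literature.Analysis.ODE.Carleman

/-! ### The back-substitution step -/

/-- Derivative of the integrating factor `s ↦ exp(−κ s)`. [folklore] -/
private theorem hasDerivAt_exp_neg_mul (κ s : ℝ) :
    HasDerivAt (fun s : ℝ => exp (-(κ * s))) (exp (-(κ * s)) * (-κ)) s := by
  have h := ((hasDerivAt_id s).const_mul κ).neg.exp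
  simpa using h

/-- **Back-substitution step** (the scalar form of `η_j(t) = ∫₀ᵗ e^{A(t−s)} f(s) ds`,
`‖η_j(t)‖ ≤ sup‖f‖ ∫₀ᵗ e^{κ(t−s)} ds`): if `e' = κ e + f` on `[0, ∞)` with `κ < 0`, `e(0) = 0` and
`|f| ≤ B` on `[0, t)`, then `|e(t)| ≤ B (1 − e^{κt}) / (−κ)`.
[cite: LiuEtAl2021Carleman, proof of Corollary 1 (arXiv:2011.03185 §3)] -/
theorem abs_le_of_hasDerivAt_linear_forced {e f : ℝ → ℝ} {κ B t : ℝ} (hκ : κ < 0) (ht : 0 ≤ t)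
    (he : ∀ s, 0 ≤ s → HasDerivAt e (κ * e s + f s) s)
    (he0 : e 0 = 0) (hf : ∀ s ∈ Ico 0 t, |f s| ≤ B) :
    |e t| ≤ B * (1 - exp (κ * t)) / (-κ) := by
  -- integrating factor: g s = exp(-κ s) * e s has derivative exp(-κ s) * f s
  set g : ℝ → ℝ := fun s => exp (-(κ * s)) * e s with hg
  have hg' : ∀ s, 0 ≤ s → HasDerivAt g (exp (-(κ * s)) * f s) s := by
    intro s hs
    have h2 := (hasDerivAt_exp_neg_mul κ s).mul (he s hs)
    refine h2.congr_deriv ?_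
    ring
  -- majorant Bm s = B (exp(-κ s) - 1) / (-κ) with derivative B exp(-κ s)
  set Bm : ℝ → ℝ := fun s => B * (exp (-(κ * s)) - 1) / (-κ) with hBm
  have hBm' : ∀ s, HasDerivAt Bm (B * exp (-(κ * s))) s := by
    intro s
    have hκ0 : κ ≠ 0 := hκ.ne
    have h2 := (((hasDerivAt_exp_neg_mul κ s).sub_const 1).const_mul B).div_const (-κ)
    refine h2.congr_deriv ?_
    field_simp
  have hcont : ContinuousOn g (Icc 0 t) := by
    refine ContinuousOn.mul ?_ fun s hs => (he s hs.1).continuousAt.continuousWithinAt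
    exact (continuous_exp.comp (continuous_const.mul continuous_id).neg).continuousOn
  have key := image_norm_le_of_norm_deriv_right_le_deriv_boundary (f := g) (a := 0) (b := t)
    (B := Bm) (B' := fun s => B * exp (-(κ * s))) hcont
    (fun s hs => (hg' s hs.1).hasDerivWithinAt) (by simp [hg, hBm, he0]) hBm'
    (fun s hs => by
      rw [Real.norm_eq_abs, abs_mul, abs_of_pos (exp_pos _), mul_comm]
      exact mul_le_mul_of_nonneg_right (hf s hs) (exp_pos _).le)
    (right_mem_Icc.mpr ht)
  rw [Real.norm_eq_abs] at key
  have hgt : |e t| = exp (κ * t) * |g t| := by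
    rw [hg, abs_mul, abs_of_pos (exp_pos _), ← mul_assoc, ← Real.exp_add, add_neg_cancel,
      Real.exp_zero, one_mul]
  have hprod : exp (κ * t) * (exp (-(κ * t)) - 1) = 1 - exp (κ * t) := by
    rw [mul_sub, ← Real.exp_add, add_neg_cancel, Real.exp_zero, mul_one]
  calc |e t| = exp (κ * t) * |g t| := hgt
    _ ≤ exp (κ * t) * Bm t := mul_le_mul_of_nonneg_left key (exp_pos _).le
    _ = B * (exp (κ * t) * (exp (-(κ * t)) - 1)) / (-κ) := by rw [hBm]; ring
    _ = B * (1 - exp (κ * t)) / (-κ) := by rw [hprod]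

/-- Time-uniform form of the back-substitution step (`∫₀ᵗ e^{κ(t−s)} ds ≤ 1/|κ|`): under the
hypotheses of `abs_le_of_hasDerivAt_linear_forced` and `0 ≤ B`, `|e(t)| ≤ B / (−κ)`.
[cite: LiuEtAl2021Carleman, proof of Corollary 1] -/
theorem abs_le_div_of_hasDerivAt_linear_forced {e f : ℝ → ℝ} {κ B t : ℝ} (hκ : κ < 0)
    (ht : 0 ≤ t) (hB : 0 ≤ B)
    (he : ∀ s, 0 ≤ s → HasDerivAt e (κ * e s + f s) s)
    (he0 : e 0 = 0) (hf : ∀ s ∈ Ico 0 t, |f s| ≤ B) :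
    |e t| ≤ B / (-κ) := by
  have h := abs_le_of_hasDerivAt_linear_forced hκ ht he he0 hf
  have hκ' : 0 < -κ := neg_pos.mpr hκ
  refine h.trans ?_
  rw [div_le_div_iff_of_pos_right hκ']
  have : 0 ≤ B * exp (κ * t) := mul_nonneg hB (exp_pos _).le
  linarith

/-! ### Lemma 1, scalar homogeneous case: the solution does not grow -/

/-- **Liu et al. Lemma 1, scalar homogeneous case.** If `u' = b u + a u²` on `[0, ∞)` with
`|a|·|u(0)| < −b` (the condition `R < 1`; it forces `b < 0`), then `|u(t)| ≤ |u(0)|` for all `t ≥ 0`: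
on the level set `u² = u(0)²` one has `(u²)' = 2u²(b + a u) ≤ 2u(0)²(b + |a||u(0)|) < 0`, so `u²`
can never cross `u(0)²` from below (Mathlib's fencing lemma). The degenerate datum `u(0) = 0` is
excluded (there the printed `R` is `0/0`-free only because `F₀ = 0`; uniqueness would be needed).
[cite: LiuEtAl2021Carleman, Lemma 1 (case n = 1, F₀ = 0)] -/
theorem abs_le_abs_init {u : ℝ → ℝ} {a b : ℝ}
    (hu : ∀ s, 0 ≤ s → HasDerivAt u (b * u s + a * u s ^ 2) s)
    (hR : |a| * |u 0| < -b) (h0 : u 0 ≠ 0) {t : ℝ} (ht : 0 ≤ t) : |u t| ≤ |u 0| := by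
  have hsq : ∀ s, 0 ≤ s → HasDerivAt (fun s => u s ^ 2) (2 * u s * (b * u s + a * u s ^ 2)) s := by
    intro s hs
    have h := (hu s hs).pow 2
    refine h.congr_deriv ?_
    simp
  have hcont : ContinuousOn (fun s => u s ^ 2) (Icc 0 t) :=
    fun s hs => (hsq s hs.1).continuousAt.continuousWithinAt
  have key := image_le_of_deriv_right_lt_deriv_boundary (f := fun s => u s ^ 2)
    (f' := fun s => 2 * u s * (b * u s + a * u s ^ 2)) (a := 0) (b := t)
    (B := fun _ => u 0 ^ 2) (B' := fun _ => 0) hcont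
    (fun s hs => (hsq s hs.1).hasDerivWithinAt) le_rfl (fun _ => hasDerivAt_const _ _)
    (fun s _ heq => by
      -- on the level set: u s ^ 2 = u 0 ^ 2, hence |u s| = |u 0|
      have habs : |u s| = |u 0| := by
        have := congrArg Real.sqrt heq
        simpa [Real.sqrt_sq_eq_abs] using this
      have hpos : 0 < u s ^ 2 := by
        rw [heq]; positivity
      have hneg : b + a * u s < 0 := by
        have : a * u s ≤ |a| * |u 0| := by
          rw [← habs, ← abs_mul]; exact le_abs_self _
        linarith
      have : 2 * u s * (b * u s + a * u s ^ 2) = 2 * u s ^ 2 * (b + a * u s) := by ring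
      rw [this]
      exact mul_neg_of_pos_of_neg (by positivity) hneg)
    (right_mem_Icc.mpr ht)
  -- key : u t ^ 2 ≤ u 0 ^ 2
  exact sq_le_sq.mp key

/-! ### Corollary 1, scalar case: the truncation error of Carleman linearisation -/

/-- The monomials `u^j` of a solution of `u' = b u + a u²` satisfy the (infinite) Carleman system
EXACTLY: `d(u^j)/dt = j b u^j + j a u^{j+1}` (`j ≥ 1`). [cite: LiuEtAl2021Carleman, eq. (3.2)–(3.6)
(arXiv §3), case n = 1] -/
theorem hasDerivAt_pow_solution {u : ℝ → ℝ} {a b : ℝ} {s : ℝ}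
    (hu : HasDerivAt u (b * u s + a * u s ^ 2) s) (j : ℕ) (hj : 1 ≤ j) :
    HasDerivAt (fun s => u s ^ j) ((j : ℝ) * b * u s ^ j + (j : ℝ) * a * u s ^ (j + 1)) s := by
  obtain ⟨k, rfl⟩ := Nat.exists_eq_add_of_le hj
  have h := hu.pow (1 + k)
  refine h.congr_deriv ?_
  simp only [Nat.add_sub_cancel_left]
  ring

/-- **Liu et al. Corollary 1 (first bound), scalar case, with an a-priori bound.** Let `u` solve
`u' = b u + a u²` on `[0, ∞)` with `b < 0` and `|u| ≤ M` there; let `ŷ₁, …, ŷ_N` solve the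
Carleman system truncated at order `N`, `ŷ_j' = j b ŷ_j + j a ŷ_{j+1}` (`ŷ_{N+1} :≡ 0`), with the
exact initial data `ŷ_j(0) = u(0)^j`. Then for every `1 ≤ j ≤ N` and `t ≥ 0`,
`|u(t)^j − ŷ_j(t)| ≤ M^j · (M|a|/|b|)^{N+1−j}` — backward substitution from `j = N` (forcing
`N a u^{N+1}`, bounded by `N|a|M^{N+1}`) down to `j = 1`, each step costing a factor `|a|M/|b|`.
[cite: LiuEtAl2021Carleman, Corollary 1 (case n = 1)] -/
theorem truncation_error_le {u : ℝ → ℝ} {y : ℕ → ℝ → ℝ} {a b M : ℝ} {N : ℕ} (hb : b < 0)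
    (hM : 0 ≤ M)
    (hu : ∀ s, 0 ≤ s → HasDerivAt u (b * u s + a * u s ^ 2) s)
    (hbound : ∀ s, 0 ≤ s → |u s| ≤ M)
    (hy : ∀ j, 1 ≤ j → j ≤ N → ∀ s, 0 ≤ s →
      HasDerivAt (y j) ((j : ℝ) * b * y j s + (j : ℝ) * a * y (j + 1) s) s)
    (hyN : ∀ s, y (N + 1) s = 0)
    (hy0 : ∀ j, 1 ≤ j → j ≤ N → y j 0 = u 0 ^ j)
    {j : ℕ} (hj1 : 1 ≤ j) (hjN : j ≤ N) {t : ℝ} (ht : 0 ≤ t) :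
    |u t ^ j - y j t| ≤ M ^ j * (M * |a| / (-b)) ^ (N + 1 - j) := by
  have hb' : 0 < -b := neg_pos.mpr hb
  set R : ℝ := M * |a| / (-b) with hR
  have hR0 : 0 ≤ R := by positivity
  -- P m : the bound for the variable of index N + 1 - m, proved by induction on m ≤ N
  have main : ∀ m, m ≤ N → ∀ t, 0 ≤ t →
      |u t ^ (N + 1 - m) - y (N + 1 - m) t| ≤ M ^ (N + 1 - m) * R ^ m := by
    intro m
    induction m with
    | zero =>
      intro _ t ht
      simp only [Nat.sub_zero, hyN, sub_zero, pow_zero, mul_one, abs_pow]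
      exact pow_le_pow_left₀ (abs_nonneg _) (hbound t ht) _
    | succ m ih =>
      intro hm t ht
      have ih' := ih (Nat.le_of_succ_le hm)
      -- the current index j' = N - m ≥ 1, the previous one is j' + 1 = N + 1 - m
      set j' : ℕ := N + 1 - (m + 1) with hj'
      have hj'1 : 1 ≤ j' := by omega
      have hj'N : j' ≤ N := by omega
      have hprev : N + 1 - m = j' + 1 := by omega
      rw [hprev] at ih'
      -- error function and its ODE: η' = (j' b) η + j' a η_{j'+1}
      have hderiv : ∀ s, 0 ≤ s → HasDerivAt (fun s => u s ^ j' - y j' s)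
          (((j' : ℝ) * b) * (u s ^ j' - y j' s)
            + (j' : ℝ) * a * (u s ^ (j' + 1) - y (j' + 1) s)) s := by
        intro s hs
        have h := (hasDerivAt_pow_solution (hu s hs) j' hj'1).sub (hy j' hj'1 hj'N s hs)
        refine h.congr_deriv ?_
        ring
      have hforce : ∀ s ∈ Ico 0 t,
          |(j' : ℝ) * a * (u s ^ (j' + 1) - y (j' + 1) s)| ≤
            (j' : ℝ) * |a| * (M ^ (j' + 1) * R ^ m) := by
        intro s hs
        rw [abs_mul, abs_mul, Nat.abs_cast]
        exact mul_le_mul_of_nonneg_left (ih' s hs.1) (by positivity)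
      have h0 : u 0 ^ j' - y j' 0 = 0 := by rw [hy0 j' hj'1 hj'N, sub_self]
      have hκ : (j' : ℝ) * b < 0 :=
        mul_neg_of_pos_of_neg (by exact_mod_cast hj'1) hb
      have step := abs_le_div_of_hasDerivAt_linear_forced (e := fun s => u s ^ j' - y j' s)
        hκ ht (by positivity) hderiv h0 hforce
      -- B / (-κ) = M^{j'} R^{m+1}
      have hj'pos : (0 : ℝ) < j' := by exact_mod_cast hj'1
      have e : (j' : ℝ) * |a| * (M ^ (j' + 1) * R ^ m) / -((j' : ℝ) * b)
          = M ^ j' * R ^ (m + 1) := by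
        rw [hR, pow_succ, pow_succ]
        field_simp
      calc |u t ^ j' - y j' t| ≤ (j' : ℝ) * |a| * (M ^ (j' + 1) * R ^ m) / -((j' : ℝ) * b) := step
        _ = M ^ j' * R ^ (m + 1) := e
  have h := main (N + 1 - j) (by omega) t ht
  have e1 : N + 1 - (N + 1 - j) = j := by omega
  rw [e1] at h
  exact h

/-- **Liu et al. Corollary 1 (first bound), scalar case, printed form.** With
`R := |u(0)|·|a|/|b| < 1` (and `u(0) ≠ 0`), Lemma 1 supplies the a-priori bound `|u| ≤ |u(0)|`,
and the truncation error of order-`N` Carleman linearisation satisfies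
`|u(t)^j − ŷ_j(t)| ≤ |u(0)|^j R^{N+1−j}` for `1 ≤ j ≤ N`, `t ≥ 0`.
[cite: LiuEtAl2021Carleman, Corollary 1 (case n = 1); ForetsPouly2017, Thm. 4.2] -/
theorem truncation_error_le_of_R_lt_one {u : ℝ → ℝ} {y : ℕ → ℝ → ℝ} {a b : ℝ} {N : ℕ}
    (hb : b < 0)
    (hu : ∀ s, 0 ≤ s → HasDerivAt u (b * u s + a * u s ^ 2) s)
    (hR : |u 0| * |a| / (-b) < 1) (h0 : u 0 ≠ 0)
    (hy : ∀ j, 1 ≤ j → j ≤ N → ∀ s, 0 ≤ s →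
      HasDerivAt (y j) ((j : ℝ) * b * y j s + (j : ℝ) * a * y (j + 1) s) s)
    (hyN : ∀ s, y (N + 1) s = 0)
    (hy0 : ∀ j, 1 ≤ j → j ≤ N → y j 0 = u 0 ^ j)
    {j : ℕ} (hj1 : 1 ≤ j) (hjN : j ≤ N) {t : ℝ} (ht : 0 ≤ t) :
    |u t ^ j - y j t| ≤ |u 0| ^ j * (|u 0| * |a| / (-b)) ^ (N + 1 - j) := by
  have hb' : 0 < -b := neg_pos.mpr hb
  have hR' : |a| * |u 0| < -b := by
    rw [div_lt_one hb'] at hR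
    linarith [mul_comm (|u 0|) (|a|)]
  exact truncation_error_le hb (abs_nonneg _) hu
    (fun s hs => abs_le_abs_init hu hR' h0 hs) hy hyN hy0 hj1 hjN ht

/-- The headline case `j = 1`: under `R < 1` the first Carleman variable approximates the solution
itself to `|u(t) − ŷ₁(t)| ≤ |u(0)| R^N`, exponentially small in the truncation order `N`.
[cite: LiuEtAl2021Carleman, Corollary 1 (case n = 1, j = 1)] -/
theorem truncation_error_first_le_of_R_lt_one {u : ℝ → ℝ} {y : ℕ → ℝ → ℝ} {a b : ℝ} {N : ℕ}
    (hb : b < 0) (hN : 1 ≤ N)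
    (hu : ∀ s, 0 ≤ s → HasDerivAt u (b * u s + a * u s ^ 2) s)
    (hR : |u 0| * |a| / (-b) < 1) (h0 : u 0 ≠ 0)
    (hy : ∀ j, 1 ≤ j → j ≤ N → ∀ s, 0 ≤ s →
      HasDerivAt (y j) ((j : ℝ) * b * y j s + (j : ℝ) * a * y (j + 1) s) s)
    (hyN : ∀ s, y (N + 1) s = 0)
    (hy0 : ∀ j, 1 ≤ j → j ≤ N → y j 0 = u 0 ^ j)
    {t : ℝ} (ht : 0 ≤ t) :
    |u t - y 1 t| ≤ |u 0| * (|u 0| * |a| / (-b)) ^ N := by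
  have h := truncation_error_le_of_R_lt_one hb hu hR h0 hy hyN hy0 le_rfl hN ht
  simpa using h

end Literature.Analysis.ODE.Carleman
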